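import Literature.Computability.Complexity.SpaceMachinesFlat
import HarnessLib

/-!
# Flat programs: one step is LOCAL in the bottom-indexed stack representation

Toolkit under the flat normal form of `TM2` machines (`FlatPrograms.lean`: programs of
`goto j` / `push k a j` / `pop k t` acting on a program counter and `nK` stacks of symbol
numbers, `FlatProg.step`, into which every standard machine compiles, `FlatProg.compile`, and
which the polynomial-time universal step `UnivStep.ustepFn` of `UniversalStep.lean` executes).
It records the fact that makes `EVAL`-type self-checking arguments work on such runs
(R. Williams, *Nonuniform ACC circuit lower bounds*, J. ACM 61 (2014), proof of Lemma 3.1: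
a guessed circuit `E` claiming "the output of gate `j` of `C_x` evaluated on `i`" is verified by
"an appropriate ACC CIRCUIT SAT instance that checks for all inputs and all gates that the
claimed inputs to that gate are consistent with the output of the gate"; C. D. Murray,
R. R. Williams, STOC 2018, §5, the circuit `D` and the consistency condition (6)): when the
computation is a flat run rather than a circuit, the role of "the inputs to a gate" is played by
BOUNDEDLY MANY quantities of the previous configuration, provided stacks are read from the
BOTTOM — a `push` writes one cell at the height given by the old size, a `pop` forgets one, and
no other cell moves.

* `FlatProg.stk`, `FlatProg.ssize`, `FlatProg.cellB` (cell of stack `k` at height `p` from the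
  bottom), `FlatProg.top`; `FlatProg.top_eq_cellB` (the top is the cell below the size);
* the next-state functions `FlatProg.nextPc P pc tops`, `FlatProg.nextSize P nK pc k s`,
  `FlatProg.nextCell P nK pc k s p v`, driven by the instruction fetched at `pc`;
* **locality of one step**: `FlatProg.step_fst`, `FlatProg.stk_step`, `FlatProg.ssize_step`,
  `FlatProg.cellB_step` (below the new size; the number of stacks is invariant, `FlatProg.length_step` of `SpaceMachinesFlat.lean`);
* `FlatProg.Claims` — a system of claims (program counter; sizes, cells, tops per time and
  stack) and its LOCAL CONSISTENCY `FlatProg.Claims.Consistent P nK T c₀` (initial claims are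
  those of `c₀`; tops are the cells below the sizes; claims at `τ + 1` are the next-state
  functions of the claims at `τ`, for `τ < T`);
* **completeness** `FlatProg.Claims.consistent_ofRun` (the honest claims `Claims.ofRun` are
  consistent) and **soundness** `FlatProg.Claims.Consistent.sound` (consistent claims ARE the
  run: at every `τ ≤ T` the claimed program counter, sizes, cells below the sizes and tops are
  those of `(step P)^[τ] c₀`, by induction on `τ`; the content claimed for a cell above the old
  size is irrelevant, `FlatProg.nextCell_congr`);
* a priori bounds for coding the claims in fixed width: `FlatProg.iterate_fst_le` (program
  counter below any bound on the initial one and the jump targets, `Instr.maxTarget`),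
  `FlatProg.ssize_iterate_le` (sizes below the initial total plus the time,
  `stkTotal_iterate_le`), `FlatProg.cellB_iterate_le` (symbols below any bound on the initial
  and the pushed symbols, `Instr.sym`).

Everything is proved; no named fact. First client: the exponential-level simulation behind
`MurrayWilliams2018ExpLevel.lean` (the consistency circuit over a guessed `AC⁰[m]` circuit
claiming the run of the clause machine of a succinct reduction), equally the machine `A` of
Williams' Lemma 3.1 (`Williams2014_lemma_3_1`).

## References

* R. Williams, *Nonuniform ACC circuit lower bounds*, J. ACM 61(1) (2014) 2:1–2:32, Lemma 3.1
  and its proof (pp. 10–12: the circuits `D`, `E` and `VALUE(i, j)`) [Williams2014].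
* C. D. Murray, R. R. Williams, *Circuit lower bounds for nondeterministic quasi-polytime: an
  easy witness lemma for NP and NQP*, STOC 2018, §5 (EVAL-GATE, the circuit `D`, condition (6))
  [MurrayWilliams2018].
* S. Arora, B. Barak, *Computational Complexity: A Modern Approach*, CUP 2009, §1.4 (machines
  as strings; configurations and their one-step evolution) [AroraBarakCC2009].
-/

namespace Literature.Computability.Complexity

namespace FlatProg

open Function

/-! ### Bottom-indexed view of a configuration -/

/-- Stack `k` of a configuration (top first; a missing stack reads `[]`). [folklore] -/
def stk (c : Cfg) (k : ℕ) : List ℕ := c.2.getD k []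

/-- The size of stack `k`. [folklore] -/
def ssize (c : Cfg) (k : ℕ) : ℕ := (stk c k).length

/-- The symbol of stack `k` at height `p` from the BOTTOM (junk `0` at and above the size).
[folklore] -/
def cellB (c : Cfg) (k p : ℕ) : ℕ := (stk c k).reverse.getD p 0

/-- The top symbol of stack `k` (`none` if empty). [folklore] -/
def top (c : Cfg) (k : ℕ) : Option ℕ := (stk c k).head?

/-- The top symbol is the cell just below the size. [folklore] -/
theorem top_eq_cellB (c : Cfg) (k : ℕ) :
    top c k = if ssize c k = 0 then none else some (cellB c k (ssize c k - 1)) := by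
  unfold top ssize cellB
  cases h : stk c k with
  | nil => simp
  | cons a l =>
    simp only [List.length_cons, Nat.add_one_ne_zero, ↓reduceIte, Nat.add_sub_cancel,
      List.head?_cons, List.reverse_cons]
    rw [List.getD_eq_getElem?_getD, List.getElem?_append_right (by simp), List.length_reverse,
      Nat.sub_self]
    simp

/-! ### The next-state functions -/

/-- The next program counter, from the fetched instruction and the top symbols.
[cite: AroraBarakCC2009, §1.4] -/
def nextPc (P : Prog) (pc : ℕ) (tops : ℕ → Option ℕ) : ℕ :=
  match P[pc]? with
  | none => pc
  | some (.goto j) => j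
  | some (.push _ _ j) => j
  | some (.pop k t) => t.getD (tblIdx (tops k)) 0

/-- The next size of stack `k` (`nK` stacks exist). [cite: AroraBarakCC2009, §1.4] -/
def nextSize (P : Prog) (nK pc k s : ℕ) : ℕ :=
  match P[pc]? with
  | some (.push k' _ _) => if k' = k ∧ k < nK then s + 1 else s
  | some (.pop k' _) => if k' = k ∧ k < nK then s - 1 else s
  | _ => s

/-- The next content of the cell of stack `k` at height `p`, from the old size `s` of stack `k`
and the old content `v` of that cell: a `push k a _` writes `a` at height `s`, nothing else
changes a cell below the new size. [cite: AroraBarakCC2009, §1.4] -/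
def nextCell (P : Prog) (nK pc k s p v : ℕ) : ℕ :=
  match P[pc]? with
  | some (.push k' a _) => if k' = k ∧ k < nK ∧ p = s then a else v
  | _ => v

/-! ### One step is local -/

/-- `getD` after `modify` at the modified index. [folklore] -/
theorem getD_modify_self {α : Type} (f : α → α) (d : α) : ∀ (l : List α) (k : ℕ), k < l.length →
    (l.modify k f).getD k d = f (l.getD k d)
  | [], k, hk => absurd hk (Nat.not_lt_zero _)
  | a :: l, 0, _ => by simp
  | a :: l, k + 1, hk => by
    rw [List.modify_succ_cons]
    simp only [List.getD_cons_succ]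
    exact getD_modify_self f d l k (by simpa using hk)

/-- `getD` after `modify` at another index. [folklore] -/
theorem getD_modify_ne {α : Type} (f : α → α) (d : α) : ∀ (l : List α) (k k' : ℕ), k' ≠ k →
    (l.modify k' f).getD k d = l.getD k d
  | [], k, k', _ => by rw [List.modify_nil]
  | a :: l, 0, 0, h => absurd rfl h
  | a :: l, k + 1, 0, _ => by simp
  | a :: l, 0, k' + 1, _ => by rw [List.modify_succ_cons]; simp
  | a :: l, k + 1, k' + 1, h => by
    rw [List.modify_succ_cons]
    simp only [List.getD_cons_succ]
    exact getD_modify_ne f d l k k' (fun e => h (congrArg (· + 1) e))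

/-- The stacks after one instruction, in terms of the old stacks. [folklore] -/
theorem stk_apply (i : Instr) (S : List (List ℕ)) (pc k : ℕ) :
    stk (i.apply S) k =
      match i with
      | .goto _ => stk (pc, S) k
      | .push k' a _ => if k' = k ∧ k < S.length then a :: stk (pc, S) k else stk (pc, S) k
      | .pop k' _ => if k' = k ∧ k < S.length then (stk (pc, S) k).tail else stk (pc, S) k := by
  cases i with
  | goto j => rfl
  | push k' a j =>
    simp only [stk, Instr.apply]
    by_cases hk : k' = k
    · subst hk
      by_cases hlt : k' < S.length
      · rw [if_pos ⟨rfl, hlt⟩, getD_modify_self _ _ _ _ hlt]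
      · rw [if_neg (fun h => hlt h.2), List.modify_eq_self (not_lt.1 hlt)]  -- name guess
    · rw [if_neg (fun h => hk h.1), getD_modify_ne _ _ _ _ _ hk]
  | pop k' t =>
    simp only [stk, Instr.apply]
    by_cases hk : k' = k
    · subst hk
      by_cases hlt : k' < S.length
      · rw [if_pos ⟨rfl, hlt⟩, List.getD_eq_getElem?_getD, List.getElem?_set_self hlt]
        simp [List.getD_eq_getElem?_getD]
      · rw [if_neg (fun h => hlt h.2), List.set_eq_of_length_le (not_lt.1 hlt)]
    · rw [if_neg (fun h => hk h.1), List.getD_eq_getElem?_getD, List.getElem?_set_ne hk,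
        ← List.getD_eq_getElem?_getD]

/-- **The program counter after one step.** [cite: AroraBarakCC2009, §1.4] -/
theorem step_fst (P : Prog) (c : Cfg) : (step P c).1 = nextPc P c.1 (top c) := by
  unfold step nextPc
  cases P[c.1]? with
  | none => rfl
  | some i =>
    cases i with
    | goto j => rfl
    | push k a j => rfl
    | pop k t => rfl

/-- **The stacks after one step**, in terms of the old ones. [cite: AroraBarakCC2009, §1.4] -/
theorem stk_step (P : Prog) (c : Cfg) (k : ℕ) :
    stk (step P c) k =
      match P[c.1]? with
      | some (.push k' a _) => if k' = k ∧ k < c.2.length then a :: stk c k else stk c k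
      | some (.pop k' _) => if k' = k ∧ k < c.2.length then (stk c k).tail else stk c k
      | _ => stk c k := by
  unfold step
  cases h : P[c.1]? with
  | none => rfl
  | some i =>
    have := stk_apply i c.2 c.1 k
    cases i with
    | goto j => exact this
    | push k' a j => exact this
    | pop k' t => exact this

/-- **The size of a stack after one step.** [cite: AroraBarakCC2009, §1.4] -/
theorem ssize_step (P : Prog) (c : Cfg) (k : ℕ) :
    ssize (step P c) k = nextSize P c.2.length c.1 k (ssize c k) := by
  unfold ssize nextSize
  rw [stk_step]
  cases P[c.1]? with
  | none => rfl
  | some i =>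
    cases i with
    | goto j => rfl
    | push k' a j => dsimp only; split_ifs <;> simp
    | pop k' t => dsimp only; split_ifs <;> simp

/-- Cells of `a :: l` from the bottom: the old cells, then `a` at height `|l|`. [folklore] -/
theorem getD_reverse_cons (a : ℕ) (l : List ℕ) (p : ℕ) :
    (a :: l).reverse.getD p 0 = if p = l.length then a else l.reverse.getD p 0 := by
  rw [List.reverse_cons, List.getD_eq_getElem?_getD, List.getD_eq_getElem?_getD]
  rcases Nat.lt_trichotomy p l.length with hp | rfl | hp
  · rw [List.getElem?_append_left (by simpa using hp), if_neg hp.ne]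
  · rw [List.getElem?_append_right (by simp), List.length_reverse, Nat.sub_self, if_pos rfl]
    rfl
  · rw [if_neg hp.ne', List.getElem?_eq_none (by simp; omega),
      List.getElem?_eq_none (by simp; omega)]

/-- Cells of `l.tail` from the bottom, below its size, are the cells of `l`. [folklore] -/
theorem getD_reverse_tail (l : List ℕ) {p : ℕ} (hp : p < l.tail.length) :
    l.tail.reverse.getD p 0 = l.reverse.getD p 0 := by
  cases l with
  | nil => rfl
  | cons a l =>
    rw [List.tail_cons] at hp ⊢
    rw [getD_reverse_cons, if_neg hp.ne]

/-- **The cells after one step**, below the new size. [cite: AroraBarakCC2009, §1.4] -/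
theorem cellB_step (P : Prog) (c : Cfg) (k p : ℕ) (hp : p < ssize (step P c) k) :
    cellB (step P c) k p = nextCell P c.2.length c.1 k (ssize c k) p (cellB c k p) := by
  unfold cellB nextCell
  unfold ssize at hp
  rw [stk_step] at hp ⊢
  revert hp
  cases P[c.1]? with
  | none => intro; rfl
  | some i =>
    cases i with
    | goto j => intro; rfl
    | push k' a j =>
      intro hp
      dsimp only at hp ⊢
      by_cases h : k' = k ∧ k < c.2.length
      · rw [if_pos h, getD_reverse_cons]
        by_cases hps : p = (stk c k).length
        · rw [if_pos hps, if_pos ⟨h.1, h.2, hps⟩]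
        · rw [if_neg hps, if_neg (fun h' => hps h'.2.2)]
      · rw [if_neg h, if_neg (fun h' => h ⟨h'.1, h'.2.1⟩)]
    | pop k' t =>
      intro hp
      dsimp only at hp ⊢
      by_cases h : k' = k ∧ k < c.2.length
      · rw [if_pos h] at hp ⊢
        exact getD_reverse_tail _ hp
      · rw [if_neg h]

/-- Above the old size, the old content of a cell is irrelevant to its next content (the only
cell above the old size and below the new one is the freshly pushed one). [folklore] -/
theorem nextCell_congr {P : Prog} {nK pc k s p : ℕ} (v v' : ℕ) (hp : p < nextSize P nK pc k s)
    (hps : ¬ p < s) : nextCell P nK pc k s p v = nextCell P nK pc k s p v' := by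
  unfold nextSize at hp
  unfold nextCell
  revert hp
  cases P[pc]? with
  | none => intro hp; exact absurd hp hps
  | some i =>
    cases i with
    | goto j => intro hp; exact absurd hp hps
    | push k' a j =>
      intro hp
      dsimp only at hp ⊢
      by_cases h : k' = k ∧ k < nK
      · rw [if_pos h] at hp
        have hpe : p = s := by omega
        rw [if_pos ⟨h.1, h.2, hpe⟩, if_pos ⟨h.1, h.2, hpe⟩]
      · rw [if_neg h] at hp
        exact absurd hp hps
    | pop k' t =>
      intro hp
      dsimp only at hp
      exfalso
      split_ifs at hp <;> omega

/-! ### Claims about a run and their local consistency -/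

/-- A system of CLAIMS about the run of a flat program: the program counter at each time, and
for each time and stack its size, its cells from the bottom and its top symbol (the quantities
an `EVAL`-type circuit is asked to produce; Williams 2014, proof of Lemma 3.1: "given input `i`
and a gate index `j`, `E` produces the output of gate `j`"). [cite: Williams2014, Lemma 3.1 (proof)] -/
structure Claims where
  /-- Claimed program counter at time `τ`. -/
  pc : ℕ → ℕ
  /-- Claimed size of stack `k` at time `τ`. -/
  size : ℕ → ℕ → ℕ
  /-- Claimed symbol of stack `k` at height `p` (from the bottom) at time `τ`. -/
  cell : ℕ → ℕ → ℕ → ℕ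
  /-- Claimed top symbol of stack `k` at time `τ`. -/
  top : ℕ → ℕ → Option ℕ

/-- **Local consistency of claims** up to time `T`, for the program `P` on `nK` stacks started
in `c₀`: the initial claims are those of `c₀`, every claimed top is the claimed cell below the
claimed size, and the claims at time `τ + 1` are the next-state functions of the claims at time
`τ` — each condition mentions boundedly many claimed quantities (Williams 2014, proof of
Lemma 3.1: "checks for all inputs and all gates that the claimed inputs to that gate are
consistent with the output of the gate"). [cite: Williams2014, Lemma 3.1 (proof)] -/
structure Claims.Consistent (P : Prog) (nK T : ℕ) (c₀ : Cfg) (C : Claims) : Prop where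
  /-- Initial program counter. -/
  init_pc : C.pc 0 = c₀.1
  /-- Initial sizes. -/
  init_size : ∀ k, C.size 0 k = ssize c₀ k
  /-- Initial cells below the sizes. -/
  init_cell : ∀ k p, p < ssize c₀ k → C.cell 0 k p = cellB c₀ k p
  /-- Tops are the cells below the sizes. -/
  top_eq : ∀ τ, τ ≤ T → ∀ k,
    C.top τ k = if C.size τ k = 0 then none else some (C.cell τ k (C.size τ k - 1))
  /-- Program counter transition. -/
  pc_succ : ∀ τ, τ < T → C.pc (τ + 1) = nextPc P (C.pc τ) (C.top τ)
  /-- Size transition. -/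
  size_succ : ∀ τ, τ < T → ∀ k, C.size (τ + 1) k = nextSize P nK (C.pc τ) k (C.size τ k)
  /-- Cell transition, below the new size. -/
  cell_succ : ∀ τ, τ < T → ∀ k p, p < C.size (τ + 1) k →
    C.cell (τ + 1) k p = nextCell P nK (C.pc τ) k (C.size τ k) p (C.cell τ k p)

/-- **The honest claims**: the quantities of the actual run. [folklore] -/
def Claims.ofRun (P : Prog) (c₀ : Cfg) : Claims where
  pc τ := ((step P)^[τ] c₀).1
  size τ k := ssize ((step P)^[τ] c₀) k
  cell τ k p := cellB ((step P)^[τ] c₀) k p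
  top τ k := FlatProg.top ((step P)^[τ] c₀) k

/-- **Completeness: the honest claims are locally consistent.** [cite: Williams2014, Lemma 3.1 (proof)] -/
theorem Claims.consistent_ofRun (P : Prog) (T : ℕ) (c₀ : Cfg) :
    (Claims.ofRun P c₀).Consistent P c₀.2.length T c₀ where
  init_pc := rfl
  init_size _ := rfl
  init_cell _ _ _ := rfl
  top_eq τ _ k := by
    show FlatProg.top ((step P)^[τ] c₀) k = if ssize ((step P)^[τ] c₀) k = 0 then none
      else some (cellB ((step P)^[τ] c₀) k (ssize ((step P)^[τ] c₀) k - 1))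
    exact top_eq_cellB _ k
  pc_succ τ _ := by
    show ((step P)^[τ + 1] c₀).1 = nextPc P ((step P)^[τ] c₀).1 (FlatProg.top ((step P)^[τ] c₀))
    rw [iterate_succ_apply', step_fst]
  size_succ τ _ k := by
    show ssize ((step P)^[τ + 1] c₀) k =
      nextSize P c₀.2.length ((step P)^[τ] c₀).1 k (ssize ((step P)^[τ] c₀) k)
    rw [iterate_succ_apply', ssize_step, length_iterate]
  cell_succ τ _ k p hp := by
    change p < ssize ((step P)^[τ + 1] c₀) k at hp
    show cellB ((step P)^[τ + 1] c₀) k p = nextCell P c₀.2.length ((step P)^[τ] c₀).1 k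
      (ssize ((step P)^[τ] c₀) k) p (cellB ((step P)^[τ] c₀) k p)
    rw [iterate_succ_apply'] at hp ⊢
    rw [cellB_step P _ k p hp, length_iterate]

/-- **Soundness: locally consistent claims are the truth.** By induction on the time: the
claimed program counter, sizes, cells below the sizes and tops at every time `τ ≤ T` are those
of the configuration `(step P)^[τ] c₀` (Williams 2014, proof of Lemma 3.1: "Assuming `E` is a
circuit correctly computing EVAL-GATE …"; Murray–Williams 2018, §5, (6): "for all `x`, `D(x) = 0`
implies that `E(C_n^O, W_n, x, s) = C_n^{W_n}(x)`"). [cite: Williams2014, Lemma 3.1 (proof)] -/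
theorem Claims.Consistent.sound {P : Prog} {nK T : ℕ} {c₀ : Cfg} {C : Claims}
    (h : C.Consistent P nK T c₀) (hnK : c₀.2.length = nK) :
    ∀ τ, τ ≤ T →
      C.pc τ = ((step P)^[τ] c₀).1 ∧
      (∀ k, C.size τ k = ssize ((step P)^[τ] c₀) k) ∧
      (∀ k p, p < ssize ((step P)^[τ] c₀) k → C.cell τ k p = cellB ((step P)^[τ] c₀) k p) ∧
      (∀ k, C.top τ k = FlatProg.top ((step P)^[τ] c₀) k) := by
  intro τ
  induction τ with
  | zero =>
    intro _
    simp only [Function.iterate_zero, id_eq]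
    refine ⟨h.init_pc, h.init_size, h.init_cell, fun k => ?_⟩
    rw [h.top_eq 0 (Nat.zero_le _) k, top_eq_cellB, h.init_size k]
    split_ifs with h0
    · rfl
    · rw [h.init_cell k _ (by omega)]
  | succ τ ih =>
    intro hτ
    obtain ⟨hpc, hsz, hcl, htp⟩ := ih (by omega)
    have hτ' : τ < T := by omega
    set c := (step P)^[τ] c₀ with hc
    have hlen : c.2.length = nK := by rw [hc, length_iterate, hnK]
    have hstep : (step P)^[τ + 1] c₀ = step P c := by rw [iterate_succ_apply']
    -- sizes first, then cells, then the program counter and the tops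
    have hsz' : ∀ k, C.size (τ + 1) k = ssize (step P c) k := fun k => by
      rw [h.size_succ τ hτ' k, hpc, hsz k, ssize_step, hlen]
    have hcl' : ∀ k p, p < ssize (step P c) k → C.cell (τ + 1) k p = cellB (step P c) k p := by
      intro k p hp
      have hp' : p < C.size (τ + 1) k := by rw [hsz' k]; exact hp
      rw [h.cell_succ τ hτ' k p hp', cellB_step P c k p hp, hpc, hsz k, hlen]
      by_cases hps : p < ssize c k
      · rw [hcl k p hps]
      · have hpn : p < nextSize P nK c.1 k (ssize c k) := by rw [← hlen, ← ssize_step]; exact hp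
        exact nextCell_congr _ _ hpn hps
    have hpc' : C.pc (τ + 1) = (step P c).1 := by
      rw [h.pc_succ τ hτ', hpc, funext htp, step_fst]
    have htp' : ∀ k, C.top (τ + 1) k = FlatProg.top (step P c) k := fun k => by
      rw [h.top_eq (τ + 1) hτ k, top_eq_cellB, hsz' k]
      split_ifs with h0
      · rfl
      · rw [hcl' k _ (by omega)]
    rw [hstep]
    exact ⟨hpc', hsz', hcl', htp'⟩

/-! ### A priori bounds on the quantities of a run -/

/-- The largest jump target of an instruction. [folklore] -/
def Instr.maxTarget : Instr → ℕ
  | .goto j => j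
  | .push _ _ j => j
  | .pop _ t => t.foldr max 0

/-- The symbol an instruction may write (`0` if none). [folklore] -/
def Instr.sym : Instr → ℕ
  | .push _ a _ => a
  | _ => 0

/-- A table entry is at most the table's maximum. [folklore] -/
theorem getD_le_foldr_max (t : List ℕ) (i : ℕ) : t.getD i 0 ≤ t.foldr max 0 := by
  induction t generalizing i with
  | nil => simp
  | cons a t ih =>
    cases i with
    | zero => simp
    | succ i => simp only [List.getD_cons_succ, List.foldr_cons]; exact (ih i).trans (le_max_right _ _)

/-- **The program counter stays below a bound** dominating the initial one and all jump targets
(a halted program counter does not move). [folklore] -/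
theorem step_fst_le {P : Prog} {B : ℕ} (hP : ∀ i ∈ P, i.maxTarget ≤ B)
    {c : Cfg} (hc : c.1 ≤ B) : (step P c).1 ≤ B := by
  unfold step
  cases h : P[c.1]? with
  | none => exact hc
  | some i =>
    have hi : i ∈ P := List.mem_of_getElem? h
    have hB := hP i hi
    cases i with
    | goto j => exact hB
    | push k a j => exact hB
    | pop k t => exact (getD_le_foldr_max t _).trans hB

/-- The program counter stays below the bound along the run. [folklore] -/
theorem iterate_fst_le {P : Prog} {B : ℕ} (hP : ∀ i ∈ P, i.maxTarget ≤ B)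
    {c : Cfg} (hc : c.1 ≤ B) (n : ℕ) : (((step P)^[n]) c).1 ≤ B := by
  induction n with
  | zero => exact hc
  | succ n ih => rw [iterate_succ_apply']; exact step_fst_le hP ih

/-- **The sizes stay below the initial total plus the time** (`stkTotal_iterate_le`). [folklore] -/
theorem ssize_iterate_le (P : Prog) (c : Cfg) (n k : ℕ) :
    ssize (((step P)^[n]) c) k ≤ stkTotal c.2 + n := by
  refine le_trans ?_ (stkTotal_iterate_le P c n)
  unfold ssize stk stkTotal
  generalize ((step P)^[n] c).2 = S
  induction S generalizing k with
  | nil => simp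
  | cons s S ih =>
    cases k with
    | zero => simp
    | succ k => simp only [List.getD_cons_succ, List.map_cons, List.sum_cons]; exact (ih k).trans (Nat.le_add_left _ _)

/-- **The symbols stay below a bound** dominating the initial symbols and all pushed symbols.
[folklore] -/
theorem cellB_step_le {P : Prog} {N : ℕ} (hP : ∀ i ∈ P, i.sym ≤ N) {c : Cfg}
    (hc : ∀ k p, cellB c k p ≤ N) (k p : ℕ) : cellB (step P c) k p ≤ N := by
  unfold cellB
  rw [stk_step]
  cases h : P[c.1]? with
  | none => exact hc k p
  | some i =>
    have hi : i ∈ P := List.mem_of_getElem? h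
    cases i with
    | goto j => exact hc k p
    | push k' a j =>
      dsimp only
      split_ifs with h'
      · rw [getD_reverse_cons]
        split_ifs
        · exact hP _ hi
        · exact hc k p
      · exact hc k p
    | pop k' t =>
      dsimp only
      split_ifs with h'
      · by_cases hp : p < (stk c k).tail.length
        · rw [getD_reverse_tail _ hp]; exact hc k p
        · rw [List.getD_eq_getElem?_getD, List.getElem?_eq_none]
          · exact Nat.zero_le _
          · rw [List.length_reverse]; omega
      · exact hc k p

/-- The symbols stay below the bound along the run. [folklore] -/
theorem cellB_iterate_le {P : Prog} {N : ℕ} (hP : ∀ i ∈ P, i.sym ≤ N) {c : Cfg}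
    (hc : ∀ k p, cellB c k p ≤ N) (n k p : ℕ) : cellB (((step P)^[n]) c) k p ≤ N := by
  induction n generalizing k p with
  | zero => exact hc k p
  | succ n ih => rw [iterate_succ_apply']; exact cellB_step_le hP ih k p

end FlatProg

end Literature.Computability.Complexity
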